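import Literature.Geometry.Symplectic.LefschetzBaseModelReebFormula
import Literature.Geometry.Symplectic.LefschetzBaseModelLevelBounds
import HarnessLib

/-!
# The Levi gradient of the model of the Lefschetz base turns the page angle positively

Topic `Literature/Geometry/Symplectic`; a proofs-only continuation (no definition, no named
fact) of `LefschetzBaseModelReebFormula.lean` and `LefschetzBaseModelLevelBounds.lean`: the
ESTIMATE behind the transversality clause `dθ(R) > 0` of the Reeb criterion for the
handle-free base case of `palf_stein_supportedByBoundaryOpenBook`.  With the Levi gradient `G`
(`h(G, ·) = DΨ`) of `Ψ = modelFun g ε (qPert δ)` and the page angle `θ = arg w`: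
`dθ(J₀G) = Im(Dw(J₀G)/w) = Re(Dw(G)/w) = Re(w̄ · Dw(G))/‖w‖²`.

* `reeb_W_identity_real` — the page-angle identity with real coefficients:
  `Dw(G) · D = a · w + b · y² - c · p' x`, `D = 16tκ + 4εδμ(‖p'‖² + κ)`,
  `a = 8tκ + 2εδμ‖p'‖²`, `b = 4εδκ m'`, `c = 2εδμ(Θ' + ε)`;
* `exists_re_conj_w_mul_wD_pos` — **there are `δ₁, ε₁ > 0` such that for `0 < δ ≤ δ₁`,
  `0 < ε ≤ ε₁`, at every point of the level `{Ψ = 1/4}` with `w ≠ 0`: `Re(w̄ · Dw(G)) > 0`**.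
  Three regimes: `t ≥ 3/10` (`μ = m' = 0`, `Re(w̄ Dw(G)) D = 8tκ‖w‖²`); `t < 3/20` (`μ = m' = 1`,
  `Θ' = Θ'' = 0`, `‖w‖ ≥ 3/10`, `‖p'‖ ≥ 1/10`: the term `2εδ‖p'‖²‖w‖²` dominates the two
  `O(ε²δ)` terms for `ε ≤ ε₁`); `3/20 ≤ t < 3/10` (`|μ| ≤ C`, `|m'| ≤ C'`: the term `8tε‖w‖²`
  dominates the `O(εδ)` terms for `δ ≤ δ₁`).

## References

* J. B. Etnyre, *Lectures on open book decompositions and contact structures*, Clay Math.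
  Proc. 5 (2006), Lemma 3.3 and proof of Thm. 5.6. [Etnyre2006]
* I. Torisu, *Convex contact structures and fibered links in 3-manifolds*, IMRN 2000:9, 441–454.
-/

noncomputable section

open scoped Manifold ContDiff Topology ComplexConjugate
open Set Function Complex Filter

namespace Literature.Geometry.Symplectic

open Literature.Topology.FourManifolds Literature.Topology.FourManifolds.LefschetzBase
  LefschetzBaseSteinModel

/-- **The page-angle identity with real coefficients.**  For `h(G, ·) = DΨ` at `z`, with
`s = ‖x‖²`, `t = ‖y‖²`, `κ = Θ'(s) + sΘ''(s) + ε`, `μ = yMassLevi t`, `m' = yMass' t`,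
`p' = dP g x`:
`Dw(G) · (16tκ + 4εδμ(‖p'‖² + κ)) = (8tκ + 2εδμ‖p'‖²) w + (4εδκ m') y² - (2εδμ(Θ'+ε)) p' x`.
[folklore] -/
theorem reeb_W_identity_real (g : ℕ) (ε δ : ℝ) (z G : EuclideanSpace ℝ (Fin 4))
    (hG : ∀ v, fderiv ℝ (fderiv ℝ (modelFun g ε (qPert δ))) z G v +
      fderiv ℝ (fderiv ℝ (modelFun g ε (qPert δ))) z (stdComplexStructure G)
        (stdComplexStructure v) = fderiv ℝ (modelFun g ε (qPert δ)) z v) :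
    wD g z G * ((16 * ‖cy z‖ ^ 2 *
        (deriv convexProfile (‖cx z‖ ^ 2) +
          ‖cx z‖ ^ 2 * deriv (deriv convexProfile) (‖cx z‖ ^ 2) + ε) +
        4 * ε * δ * yMassLevi (‖cy z‖ ^ 2) * (‖dP g (cx z)‖ ^ 2 +
          (deriv convexProfile (‖cx z‖ ^ 2) +
            ‖cx z‖ ^ 2 * deriv (deriv convexProfile) (‖cx z‖ ^ 2) + ε)) : ℝ) : ℂ) =
      ((8 * ‖cy z‖ ^ 2 *
          (deriv convexProfile (‖cx z‖ ^ 2) +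
            ‖cx z‖ ^ 2 * deriv (deriv convexProfile) (‖cx z‖ ^ 2) + ε) +
        2 * ε * δ * yMassLevi (‖cy z‖ ^ 2) * ‖dP g (cx z)‖ ^ 2 : ℝ) : ℂ) * w g z +
        ((4 * ε * δ * deriv yMass (‖cy z‖ ^ 2) *
          (deriv convexProfile (‖cx z‖ ^ 2) +
            ‖cx z‖ ^ 2 * deriv (deriv convexProfile) (‖cx z‖ ^ 2) + ε) : ℝ) : ℂ) * cy z ^ 2 -
        ((2 * ε * δ * yMassLevi (‖cy z‖ ^ 2) * (deriv convexProfile (‖cx z‖ ^ 2) + ε) : ℝ) : ℂ) *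
          dP g (cx z) * cx z := by
  have h := reeb_W_identity_modelFun g ε δ z G hG
  rw [Complex.conj_mul', Complex.conj_mul'] at h
  push_cast at h ⊢
  linear_combination h

/-- Real-inequality core of the regime `t < 3/20` (`μ = m' = 1`). [folklore] -/
theorem reeb_regimeSmall_pos {ε δ t nw np nx P R₁ R₂ : ℝ} (hε : 0 < ε) (hδ : 0 < δ)
    (ht0 : 0 ≤ t) (ht : t < 3 / 20) (hw : 3 / 10 ≤ nw) (hp : 1 / 10 ≤ np) (hpP : np ≤ P)
    (hx0 : 0 ≤ nx) (hx : nx ≤ 2) (hεP : ε * (3 / 10 + 2 * P + 1) ≤ 3 / 1000)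
    (h1 : -(nw * t) ≤ R₁) (h2 : R₂ ≤ nw * (np * nx)) :
    0 < (8 * t * ε + 2 * ε * δ * 1 * np ^ 2) * nw ^ 2 + 4 * ε * δ * 1 * ε * R₁ -
      2 * ε * δ * 1 * ε * R₂ := by
  have hp0 : 0 ≤ np := by linarith
  have hP0 : 0 ≤ P := hp0.trans hpP
  have hp2 : 1 / 100 ≤ np ^ 2 := by
    have := pow_le_pow_left₀ (by norm_num : (0 : ℝ) ≤ 1 / 10) hp 2
    norm_num at this
    exact this
  have hpx : np * nx ≤ P * 2 := mul_le_mul hpP hx hx0 hP0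
  have h3 : 1 / 100 * (3 / 10) ≤ np ^ 2 * nw := mul_le_mul hp2 hw (by norm_num) (by positivity)
  have key : ε * (2 * t + np * nx) < np ^ 2 * nw := by
    have h4 : ε * (2 * t + np * nx) ≤ ε * (3 / 10 + 2 * P) :=
      mul_le_mul_of_nonneg_left (by linarith) hε.le
    linarith
  have c1 := mul_le_mul_of_nonneg_left h1 (by positivity : 0 ≤ 4 * ε * ε * δ)
  have c2 := mul_le_mul_of_nonneg_left h2 (by positivity : 0 ≤ 2 * ε * ε * δ)
  have c3 := mul_lt_mul_of_pos_left key (by positivity : 0 < 2 * ε * δ * nw)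
  have hpos1 : 0 ≤ 8 * t * ε * nw ^ 2 := by positivity
  linarith

/-- Real-inequality core of the regime `3/20 ≤ t < 3/10` (`|μ| ≤ C`, `|m'| ≤ C'`), numerator.
[folklore] -/
theorem reeb_regimeMid_pos {ε δ t nw np nx P C C' μ m' R₁ R₂ : ℝ} (hε : 0 < ε) (hε1 : ε ≤ 1)
    (hδ : 0 < δ) (ht : 3 / 20 ≤ t) (ht' : t < 3 / 10) (hw : 3 / 10 ≤ nw) (hw' : nw ≤ 1 / 2)
    (hp0 : 0 ≤ np) (hpP : np ≤ P) (hx0 : 0 ≤ nx) (hx : nx ≤ 2) (hC0 : 0 ≤ C) (hC'0 : 0 ≤ C')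
    (hμ : |μ| ≤ C) (hm : |m'| ≤ C')
    (hδden : δ * (C * P ^ 2 + 6 / 5 * C' + 4 * C * P + 1) ≤ 9 / 25)
    (h1 : |R₁| ≤ nw * t) (h2 : |R₂| ≤ nw * (np * nx)) :
    0 < (8 * t * ε + 2 * ε * δ * μ * np ^ 2) * nw ^ 2 + 4 * ε * δ * m' * ε * R₁ -
      2 * ε * δ * μ * ε * R₂ := by
  have hP0 : 0 ≤ P := hp0.trans hpP
  have hnw : 0 < nw := by linarith
  have hμl : -C ≤ μ := (abs_le.1 hμ).1
  have hp2 : np ^ 2 ≤ P ^ 2 := pow_le_pow_left₀ hp0 hpP 2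
  -- lower bounds for the three `δ`-terms
  have e1 : -(2 * ε * δ * C * P ^ 2 * nw ^ 2) ≤ 2 * ε * δ * μ * np ^ 2 * nw ^ 2 := by
    have : 0 ≤ 2 * ε * δ * nw ^ 2 * ((μ + C) * np ^ 2 + C * (P ^ 2 - np ^ 2)) :=
      mul_nonneg (by positivity)
        (add_nonneg (mul_nonneg (by linarith) (sq_nonneg _)) (mul_nonneg hC0 (by linarith)))
    linarith
  have e2 : -(4 * ε * ε * δ * C' * (nw * t)) ≤ 4 * ε * δ * m' * ε * R₁ := by
    have hR : |m' * R₁| ≤ C' * (nw * t) := by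
      rw [abs_mul]; exact mul_le_mul hm h1 (abs_nonneg _) hC'0
    have h3 := mul_le_mul_of_nonneg_left (abs_le.1 hR).1 (by positivity : 0 ≤ 4 * ε * ε * δ)
    linarith
  have e3 : -(2 * ε * ε * δ * C * (nw * (np * nx))) ≤ -(2 * ε * δ * μ * ε * R₂) := by
    have hR : |μ * R₂| ≤ C * (nw * (np * nx)) := by
      rw [abs_mul]; exact mul_le_mul hμ h2 (abs_nonneg _) hC0
    have h3 := mul_le_mul_of_nonneg_left (abs_le.1 hR).2 (by positivity : 0 ≤ 2 * ε * ε * δ)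
    linarith
  -- the main term and the error terms in units of `ε nw δ`
  have m1 : 9 / 25 * ε * nw ≤ 8 * t * ε * nw ^ 2 := by
    have h3 : 3 / 20 * (3 / 10) ≤ t * nw := mul_le_mul ht hw (by norm_num) (by linarith)
    have h4 := mul_le_mul_of_nonneg_left h3 (by positivity : 0 ≤ 8 * ε * nw)
    linarith
  have b1 : 2 * ε * δ * C * P ^ 2 * nw ^ 2 ≤ ε * nw * δ * (C * P ^ 2) := by
    have : 0 ≤ ε * δ * C * P ^ 2 * nw * (1 - 2 * nw) :=
      mul_nonneg (by positivity) (by linarith)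
    linarith
  have b2 : 4 * ε * ε * δ * C' * (nw * t) ≤ ε * nw * δ * (6 / 5 * C') := by
    have h3 : ε * t ≤ 1 * (3 / 10) := mul_le_mul hε1 ht'.le (by linarith) zero_le_one
    have : 0 ≤ ε * δ * C' * nw * (6 / 5 - 4 * (ε * t)) :=
      mul_nonneg (by positivity) (by linarith)
    linarith
  have b3 : 2 * ε * ε * δ * C * (nw * (np * nx)) ≤ ε * nw * δ * (4 * C * P) := by
    have hpx : np * nx ≤ P * 2 := mul_le_mul hpP hx hx0 hP0
    have h3 : ε * (np * nx) ≤ 1 * (P * 2) := mul_le_mul hε1 hpx (mul_nonneg hp0 hx0) zero_le_one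
    have : 0 ≤ ε * δ * C * nw * (4 * P - 2 * (ε * (np * nx))) :=
      mul_nonneg (by positivity) (by linarith)
    linarith
  have fin : ε * nw * δ * (C * P ^ 2 + 6 / 5 * C' + 4 * C * P) < 9 / 25 * ε * nw := by
    have h3 : δ * (C * P ^ 2 + 6 / 5 * C' + 4 * C * P) < 9 / 25 := by linarith
    have := mul_lt_mul_of_pos_left h3 (mul_pos hε hnw)
    linarith
  linarith

/-- Real-inequality core of the regime `3/20 ≤ t < 3/10`, denominator. [folklore] -/
theorem reeb_regimeMid_den_pos {ε δ t np P C μ : ℝ} (hε : 0 < ε) (hε1 : ε ≤ 1) (hδ : 0 < δ)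
    (ht : 3 / 20 ≤ t) (hp0 : 0 ≤ np) (hpP : np ≤ P) (hC0 : 0 ≤ C) (hμ : |μ| ≤ C)
    (hδden : δ * (C * (P ^ 2 + 1) + 1) ≤ 3 / 5) :
    0 < 16 * t * ε + 4 * ε * δ * μ * (np ^ 2 + ε) := by
  have hμl : -C ≤ μ := (abs_le.1 hμ).1
  have hp2 : np ^ 2 ≤ P ^ 2 := pow_le_pow_left₀ hp0 hpP 2
  have e1 : -(4 * ε * δ * C * (P ^ 2 + 1)) ≤ 4 * ε * δ * μ * (np ^ 2 + ε) := by
    have : 0 ≤ 4 * ε * δ * ((μ + C) * (np ^ 2 + ε) + C * (P ^ 2 + 1 - (np ^ 2 + ε))) :=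
      mul_nonneg (by positivity)
        (add_nonneg (mul_nonneg (by linarith) (by positivity)) (mul_nonneg hC0 (by linarith)))
    linarith
  have m1 : 12 / 5 * ε ≤ 16 * t * ε := mul_le_mul_of_nonneg_right (by linarith) hε.le
  have fin : 4 * ε * δ * C * (P ^ 2 + 1) < 12 / 5 * ε := by
    have h3 : δ * (C * (P ^ 2 + 1)) < 3 / 5 := by linarith
    have := mul_lt_mul_of_pos_left h3 (by positivity : 0 < 4 * ε)
    linarith
  linarith

/-- **Positivity of the page-angle derivative of the Levi gradient.**  There are `δ₁ > 0` and
`ε₁ > 0` such that for `0 < δ ≤ δ₁`, `0 < ε ≤ ε₁`, at every point `z` of the level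
`{modelFun g ε (qPert δ) = 1/4}` with `w z ≠ 0`, every solution `G` of `h(G, ·) = DΨ_z` has
`Re(w̄ · Dw(G)) > 0` — the Reeb field `J₀G` is positively transverse to the pages `arg w = const`.
[cite: Etnyre2006, Lemma 3.3] -/
theorem exists_re_conj_w_mul_wD_pos (g : ℕ) :
    ∃ δ₁ : ℝ, 0 < δ₁ ∧ ∃ ε₁ : ℝ, 0 < ε₁ ∧ ∀ δ : ℝ, 0 < δ → δ ≤ δ₁ → ∀ ε : ℝ, 0 < ε → ε ≤ ε₁ →
      ∀ z G : EuclideanSpace ℝ (Fin 4), modelFun g ε (qPert δ) z = 1 / 4 → w g z ≠ 0 →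
        (∀ v, fderiv ℝ (fderiv ℝ (modelFun g ε (qPert δ))) z G v +
          fderiv ℝ (fderiv ℝ (modelFun g ε (qPert δ))) z (stdComplexStructure G)
            (stdComplexStructure v) = fderiv ℝ (modelFun g ε (qPert δ)) z v) →
        0 < (conj (w g z) * wD g z G).re := by
  obtain ⟨P, hP0, hP⟩ := exists_bound_dP g
  obtain ⟨C, hC0, hC⟩ := exists_bound_yMassLevi
  obtain ⟨C', hC'0, hC'⟩ := exists_bound_deriv_yMass
  set δ₁ : ℝ := min 1 (min (9 / 25 / (C * P ^ 2 + 6 / 5 * C' + 4 * C * P + 1))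
    (3 / 5 / (C * (P ^ 2 + 1) + 1))) with hδ₁
  set ε₁ : ℝ := min (1 / 40) (3 / 1000 / (3 / 10 + 2 * P + 1)) with hε₁
  have hδ₁pos : 0 < δ₁ := lt_min one_pos (lt_min (by positivity) (by positivity))
  have hε₁pos : 0 < ε₁ := lt_min (by norm_num) (by positivity)
  refine ⟨δ₁, hδ₁pos, ε₁, hε₁pos, fun δ hδ hδδ₁ ε hε hεε₁ z G hz hw hG => ?_⟩
  have hδ1 : δ ≤ 1 := hδδ₁.trans (min_le_left _ _)
  have hδ2 : δ ≤ 9 / 25 / (C * P ^ 2 + 6 / 5 * C' + 4 * C * P + 1) :=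
    hδδ₁.trans ((min_le_right _ _).trans (min_le_left _ _))
  have hδ3 : δ ≤ 3 / 5 / (C * (P ^ 2 + 1) + 1) :=
    hδδ₁.trans ((min_le_right _ _).trans (min_le_right _ _))
  have hε40 : ε ≤ 1 / 40 := hεε₁.trans (min_le_left _ _)
  have hε2 : ε ≤ 3 / 1000 / (3 / 10 + 2 * P + 1) := hεε₁.trans (min_le_right _ _)
  have hε1 : ε ≤ 1 := hε40.trans (by norm_num)
  -- notation
  set t : ℝ := ‖cy z‖ ^ 2 with ht
  set κ₀ : ℝ := deriv convexProfile (‖cx z‖ ^ 2) +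
    ‖cx z‖ ^ 2 * deriv (deriv convexProfile) (‖cx z‖ ^ 2) with hκ₀
  set μ : ℝ := yMassLevi t with hμ
  set m' : ℝ := deriv yMass t with hm'
  set p' : ℂ := dP g (cx z) with hp'
  have ht0 : 0 ≤ t := sq_nonneg _
  have hκ₀0 : 0 ≤ κ₀ := levi_coeff_convexProfile_nonneg (sq_nonneg _)
  have hκ : 0 < κ₀ + ε := by linarith
  have hrho : rho g z ≤ 1 / 4 := rho_le_of_level hε.le hδ.le hz.le
  have hPz : ‖p'‖ ≤ P := hP z hrho
  have hw2 : ‖w g z‖ ^ 2 ≤ 1 / 4 := norm_w_sq_le_of_level hε.le hδ.le hz.le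
  have hwpos : 0 < ‖w g z‖ := norm_pos_iff.2 hw
  have hwle : ‖w g z‖ ≤ 1 / 2 := by nlinarith [norm_nonneg (w g z)]
  -- the identity
  have hid := reeb_W_identity_real g ε δ z G hG
  simp only [← ht, ← hκ₀, ← hμ, ← hm', ← hp'] at hid
  set D : ℝ := 16 * t * (κ₀ + ε) + 4 * ε * δ * μ * (‖p'‖ ^ 2 + (κ₀ + ε)) with hD
  set N : ℂ := ((8 * t * (κ₀ + ε) + 2 * ε * δ * μ * ‖p'‖ ^ 2 : ℝ) : ℂ) * w g z +
    ((4 * ε * δ * m' * (κ₀ + ε) : ℝ) : ℂ) * cy z ^ 2 -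
    ((2 * ε * δ * μ * (deriv convexProfile (‖cx z‖ ^ 2) + ε) : ℝ) : ℂ) * p' * cx z with hN
  have hid' : wD g z G * (D : ℂ) = N := hid
  -- `Re(w̄ W) D = Re(w̄ N)`
  have hre : (conj (w g z) * wD g z G).re * D = (conj (w g z) * N).re := by
    rw [← Complex.re_mul_ofReal, mul_assoc, hid']
  -- `Re(w̄ N)` expanded
  have hreN : (conj (w g z) * N).re =
      (8 * t * (κ₀ + ε) + 2 * ε * δ * μ * ‖p'‖ ^ 2) * ‖w g z‖ ^ 2 +
        4 * ε * δ * m' * (κ₀ + ε) * (conj (w g z) * cy z ^ 2).re -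
        2 * ε * δ * μ * (deriv convexProfile (‖cx z‖ ^ 2) + ε) *
          (conj (w g z) * (p' * cx z)).re := by
    have e : conj (w g z) * N =
        ((8 * t * (κ₀ + ε) + 2 * ε * δ * μ * ‖p'‖ ^ 2 : ℝ) : ℂ) * (conj (w g z) * w g z) +
          ((4 * ε * δ * m' * (κ₀ + ε) : ℝ) : ℂ) * (conj (w g z) * cy z ^ 2) -
          ((2 * ε * δ * μ * (deriv convexProfile (‖cx z‖ ^ 2) + ε) : ℝ) : ℂ) *
            (conj (w g z) * (p' * cx z)) := by
      rw [hN]; ring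
    rw [e, Complex.conj_mul', ← Complex.ofReal_pow]
    simp only [Complex.sub_re, Complex.add_re, Complex.re_ofReal_mul, ← Complex.ofReal_mul,
      Complex.ofReal_re]
  -- bounds for the cross terms
  have hb1 : |(conj (w g z) * cy z ^ 2).re| ≤ ‖w g z‖ * t := by
    have := abs_re_le_norm (conj (w g z) * cy z ^ 2)
    rwa [norm_mul, Complex.norm_conj, norm_pow] at this
  have hb2 : |(conj (w g z) * (p' * cx z)).re| ≤ ‖w g z‖ * (‖p'‖ * ‖cx z‖) := by
    have := abs_re_le_norm (conj (w g z) * (p' * cx z))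
    rwa [norm_mul, Complex.norm_conj, norm_mul] at this
  -- it suffices to show `Re(w̄ N) > 0` and `D > 0`
  suffices hmain : 0 < (conj (w g z) * N).re ∧ 0 < D by
    by_contra hneg
    rw [not_lt] at hneg
    have : (conj (w g z) * wD g z G).re * D ≤ 0 :=
      mul_nonpos_of_nonpos_of_nonneg hneg hmain.2.le
    linarith [hmain.1]
  rcases lt_or_ge t (3 / 10) with htlt | htge
  · -- the cut-off region: `Θ' = Θ'' = 0`, `‖w‖ ≥ 3/10`, `‖p'‖ ≥ 1/10`, `‖x‖ ≤ 2`
    have hs4 : ‖cx z‖ ^ 2 < 4 := norm_sq_cx_lt_four_of_level hε.le hδ.le hz.le htlt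
    have hΘ1 : deriv convexProfile (‖cx z‖ ^ 2) = 0 := deriv_convexProfile_eq_zero_of_lt hs4
    have hΘ2 : deriv (deriv convexProfile) (‖cx z‖ ^ 2) = 0 :=
      deriv_deriv_convexProfile_eq_zero_of_lt hs4
    have hκ₀z : κ₀ = 0 := by rw [hκ₀, hΘ1, hΘ2, mul_zero, add_zero]
    have hwge : 3 / 10 ≤ ‖w g z‖ := norm_w_ge_of_level hε.le hε40 hδ.le hδ1 hz htlt
    have hpge : 1 / 10 ≤ ‖p'‖ := norm_dP_ge_of_level hε.le hδ.le hz.le htlt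
    have hx2 : ‖cx z‖ ≤ 2 := by nlinarith [norm_nonneg (cx z)]
    have hx0 : 0 ≤ ‖cx z‖ := norm_nonneg _
    rw [hκ₀z, zero_add, hΘ1, zero_add] at hreN
    rw [hκ₀z, zero_add] at hD
    rcases lt_or_ge t (3 / 20) with ht1 | ht1
    · -- `t < 3/20`: `μ = m' = 1`
      have hμ1 : μ = 1 := yMassLevi_of_lt ht1
      have hm1 : m' = 1 := deriv_yMass_of_lt ht1
      rw [hμ1, hm1] at hreN
      rw [hμ1] at hD
      have hεP : ε * (3 / 10 + 2 * P + 1) ≤ 3 / 1000 := by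
        rwa [le_div_iff₀ (by positivity)] at hε2
      constructor
      · rw [hreN]
        exact reeb_regimeSmall_pos hε hδ ht0 ht1 hwge hpge hPz hx0 hx2 hεP (abs_le.1 hb1).1
          (abs_le.1 hb2).2
      · rw [hD]
        have : 0 < 4 * ε * δ * 1 * (‖p'‖ ^ 2 + ε) := by positivity
        positivity
    · -- `3/20 ≤ t < 3/10`: `|μ| ≤ C`, `|m'| ≤ C'`
      have hμC : |μ| ≤ C := hC t ht0
      have hmC : |m'| ≤ C' := hC' t ht0
      have hδden : δ * (C * P ^ 2 + 6 / 5 * C' + 4 * C * P + 1) ≤ 9 / 25 := by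
        rwa [le_div_iff₀ (by positivity)] at hδ2
      have hδden' : δ * (C * (P ^ 2 + 1) + 1) ≤ 3 / 5 := by
        rwa [le_div_iff₀ (by positivity)] at hδ3
      constructor
      · rw [hreN]
        exact reeb_regimeMid_pos hε hε1 hδ ht1 htlt hwge hwle (norm_nonneg _) hPz hx0 hx2 hC0
          hC'0 hμC hmC hδden hb1 hb2
      · rw [hD]
        exact reeb_regimeMid_den_pos hε hε1 hδ ht1 (norm_nonneg _) hPz hC0 hμC hδden'
  · -- `t ≥ 3/10`: `μ = m' = 0`
    have hμ0 : μ = 0 := yMassLevi_of_ge htge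
    have hm0 : m' = 0 := deriv_yMass_of_ge htge
    rw [hμ0, hm0] at hreN
    rw [hμ0] at hD
    have htpos : 0 < t := by linarith
    constructor
    · rw [hreN]
      have : 0 < 8 * t * (κ₀ + ε) * ‖w g z‖ ^ 2 := by positivity
      linarith
    · rw [hD]
      have : 0 < 16 * t * (κ₀ + ε) := by positivity
      linarith

end Literature.Geometry.Symplectic

end
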